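import Mathlib
import HarnessLib
import Summits.Ventures.LatticeQCDFlow.Exactness.SphereGeodesicKick
import Summits.Ventures.LatticeQCDFlow.Exactness.ComplexSphereAction
import Summits.Ventures.LatticeQCDFlow.Exactness.SphereKickJacobian
import Summits.Ventures.LatticeQCDFlow.Exactness.SphereLOFlowAction
import Summits.Ventures.LatticeQCDFlow.Exactness.SphereLOFlowDivergence

/-!
# Link-transported nearest-neighbour couplings inhabit the hypotheses: the gauged CP(N−1)/O(N) action on any graph (E–S eqs. (1), (6)–(7)) has no self-coupling and adjoint-pair couplings, so eqs. (15)–(17) and Lüscher's LO criterion apply to it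

HONEST FRAMING: exact (Metropolis-corrected) sampling algorithms for lattice gauge theory;
figures of merit are autocorrelation/cost numbers at stated couplings and volumes; no
continuum-physics claim.

Venture `LatticeQCDFlow` (cell pub-lqcd), topic `Exactness`; FANOUT row 7 (`s0-cpn-null`: the
S0-D1 rung — 2D CP⁹, Lüscher's LO trivializing map inside HMC, Engel–Schaefer 2011).  NEW WORK of
the cell over Mathlib and the tree's `SphereLOFlowAction.lean` / `SphereLOFlowDivergence.lean`
(whose theorems carry the two hypotheses `U n n = 0` and `⟪U m n v, w⟫ = ⟪v, U n m w⟫` on the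
couplings); nothing is cited as a fact.  Printed counterpart, NAMED ONLY: Engel–Schaefer, Comput.
Phys. Commun. 182 (2011) 2107, §2 eq. (1) (`S[z, λ] = −Nβ Σ_{n,μ} (z†_{n+μ̂} z_n λ_{n,μ} + c.c. − 2)`),
eqs. (6)–(7) (`S[x, φ] = −Nβ Σ_n (x_nᵀ J_n − 4)`, `J_n = Σ_μ Λᵀ_{n,μ} x_{n+μ̂}`,
`Λ_{n,−μ} := Λᵀ_{n−μ̂,μ}`), §3 eqs. (15)–(17).

## Setting

`E` a real inner product space, `Λ` a finite set of sites, `Lk` a finite set of ORIENTED LINKS with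
endpoints `src, tgt : Lk → Λ` and a transporter `R ℓ : E ≃ₗᵢ[ℝ] E` on each link (for CP(N−1): the
`U(1)` phase `λ_ℓ = e^{iφ_ℓ}` acting on `ℂ^N ≅ ℝ^{2N}` by the block rotation `Λ(φ_ℓ)` — any linear
isometry is allowed, so the O(N) model (`R = 1`) and non-abelian transporters are covered too; the
graph is arbitrary: the periodic square lattice of the rung is `Lk = Λ × {1, 2}`, `tgt (n, μ) = n + μ̂`).

* `linkCoupling src tgt R n m = Σ_{ℓ : n → m} R_ℓ⁻¹ + Σ_{ℓ : m → n} R_ℓ` — the coupling fed to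
  `SphereLOFlowAction.esAction` (so that `J_n = Σ_{ℓ : src ℓ = n} R_ℓ⁻¹ x_{tgt ℓ} + Σ_{ℓ : tgt ℓ = n}
  R_ℓ x_{src ℓ}`, E–S eq. (7));
* `linkAction κ S₀ src tgt R x = −2κ Σ_ℓ ⟪x_{tgt ℓ}, R_ℓ x_{src ℓ}⟫ + S₀` — E–S eq. (1) in real form
  (`2 Re(z†_{tgt} λ z_{src}) = 2 ⟪x_{tgt}, Λ x_{src}⟫`; `κ = Nβ`, `S₀ = 2κ · #Lk = 4NβV`).

## Content

* **`linkCoupling_self`** — no self-coupling, `U n n = 0`, as soon as the graph has no loops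
  (`src ℓ ≠ tgt ℓ`); **`inner_linkCoupling`** — adjoint pairs, `⟪U m n v, w⟫ = ⟪v, U n m w⟫`
  (a transporter and its inverse sit on the two orientations).  THE HYPOTHESES OF
  `SphereLOFlowAction.lean` / `SphereLOFlowDivergence.lean` ARE INHABITED BY THE MODEL OF RECORD.
* `localField_linkCoupling` (E–S eq. (7)) and **`esAction_linkCoupling`** (eq. (6) = eq. (1)):
  `esAction κ S₀ (linkCoupling …) = linkAction κ S₀ …` — each link is counted twice in `Σ_n x_nᵀJ_n`.
* The consequences, hypothesis-free but for "no loops" (and `d ≥ 2`, `‖x n‖ = 1`):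
  **`neg_sum_siteLaplacian_linkAction`** (E–S eq. (15): `−Σ_n ∂̃_n·∂̃_n (S/(2(d−1))) = S − S₀`),
  **`loGenerator_link_eq`** (eq. (16): `T_n = (κ/(d−1)) p_n`), **`eulerStep_loGenerator_link`**
  (eq. (17): the Euler step is `geodesicKick (ε κ/(d−1)) J_n x_n`),
  **`coe_sphereKick_eq_eulerStep_loGenerator`** (GEN-5's swept site map `sphereKick c J_n`, `c =
  ε κ/(d−1)`, IS that Euler step — the bridge to the THMC exactness theorems `SphereSweepTHMC*`),
  **`sum_siteDiv_loGenerator_link`** (Lüscher's criterion at `t = 0`: `Σ_n div_n T = S − S₀`).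

* §3 THE CP(N−1) DICTIONARY (row 9's realification `ComplexSphereAction.lean`: `E n = ℝ^{n ⊕ n} ≅ ℂ^n`,
  `cplx`, `rotC`): `phaseRot c` — the `U(1)` phase `c` (`‖c‖ = 1`) acting on `ℂ^N` as a real linear
  isometry of `ℝ^{2N}` (`cplx_phaseRot`: it multiplies the complex coordinates by `c`);
  `inner_eq_re_sum_conj_mul` (`⟪x, y⟫ = Re Σᵢ conj(zᵢ) wᵢ`); **`linkAction_phase`**,
  **`linkAction_phase_es`** — with phases as transporters the link action is E–S eq. (1) VERBATIM:
  `−κ Σ_ℓ (2 Re(z†_{tgt ℓ} λ_ℓ z_{src ℓ}) − 2)` for `S₀ = 2κ · #Lk` (`κ = Nβ`).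

NOT CLAIMED: the link (`U(1)`) update — the phases are parameters of the map, as in E–S §3;
periodicity or dimension of the lattice (any finite loop-free graph); anything quantitative.
-/

noncomputable section

namespace Summit.Ventures.LatticeQCDFlow.Exactness

open NormedSpace Filter
open scoped RealInnerProductSpace

variable {E : Type*} [NormedAddCommGroup E] [InnerProductSpace ℝ E]
variable {Λ : Type*} [DecidableEq Λ] {Lk : Type*} [Fintype Lk]

/-! ## §1 The link coupling and the action in link form -/

section Links

/-- **The link-transported nearest-neighbour coupling**: `U n m = Σ_{ℓ : n → m} R_ℓ⁻¹ + Σ_{ℓ : m → n} R_ℓ`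
(E–S eq. (7): `Λᵀ_{n,μ}` towards the forward neighbour, `Λ_{n−μ̂,μ}` towards the backward one). -/
def linkCoupling (src tgt : Lk → Λ) (R : Lk → (E ≃ₗᵢ[ℝ] E)) (n m : Λ) : E →L[ℝ] E :=
  ∑ ℓ ∈ Finset.univ.filter (fun ℓ => src ℓ = n ∧ tgt ℓ = m),
      (R ℓ).symm.toLinearIsometry.toContinuousLinearMap +
    ∑ ℓ ∈ Finset.univ.filter (fun ℓ => src ℓ = m ∧ tgt ℓ = n),
      (R ℓ).toLinearIsometry.toContinuousLinearMap

/-- **The action in link form** (E–S eq. (1), real coordinates):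
`S = −2κ Σ_ℓ ⟪x_{tgt ℓ}, R_ℓ x_{src ℓ}⟫ + S₀`. -/
def linkAction (κ S₀ : ℝ) (src tgt : Lk → Λ) (R : Lk → (E ≃ₗᵢ[ℝ] E)) (x : Λ → E) : ℝ :=
  -(2 * κ) * ∑ ℓ, ⟪x (tgt ℓ), R ℓ (x (src ℓ))⟫ + S₀

variable (src tgt : Lk → Λ) (R : Lk → (E ≃ₗᵢ[ℝ] E))

/-- The coupling applied to a vector, as a sum of `if`s over all links. -/
theorem linkCoupling_apply (n m : Λ) (v : E) :
    linkCoupling src tgt R n m v =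
      ∑ ℓ, ((if src ℓ = n ∧ tgt ℓ = m then (R ℓ).symm v else 0) +
        (if src ℓ = m ∧ tgt ℓ = n then R ℓ v else 0)) := by
  simp only [linkCoupling, add_apply, sum_apply, LinearIsometry.coe_toContinuousLinearMap,
    LinearIsometryEquiv.coe_toLinearIsometry]
  simp only [Finset.sum_filter, Finset.sum_add_distrib]

/-- **No self-coupling**: on a graph without loops, `U n n = 0`. -/
theorem linkCoupling_self (hloop : ∀ ℓ, src ℓ ≠ tgt ℓ) (n : Λ) :
    linkCoupling src tgt R n n = 0 := by
  ext v
  rw [linkCoupling_apply, zero_apply]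
  refine Finset.sum_eq_zero fun ℓ _ => ?_
  have h : ¬(src ℓ = n ∧ tgt ℓ = n) := fun h => hloop ℓ (h.1.trans h.2.symm)
  simp [h]

/-- A transporter and its inverse are mutually adjoint: `⟪R⁻¹ v, w⟫ = ⟪v, R w⟫`. -/
theorem inner_symm_apply_left (S : E ≃ₗᵢ[ℝ] E) (v w : E) : ⟪S.symm v, w⟫ = ⟪v, S w⟫ := by
  rw [← S.inner_map_map (S.symm v) w, LinearIsometryEquiv.apply_symm_apply]

/-- `⟪R v, w⟫ = ⟪v, R⁻¹ w⟫`. -/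
theorem inner_apply_left_eq_symm (S : E ≃ₗᵢ[ℝ] E) (v w : E) : ⟪S v, w⟫ = ⟪v, S.symm w⟫ := by
  rw [← S.inner_map_map v (S.symm w), LinearIsometryEquiv.apply_symm_apply]

/-- **Adjoint pairs**: `⟪U m n v, w⟫ = ⟪v, U n m w⟫` — the two orientations of a link carry a
transporter and its inverse (E–S: `Λ_{n,−μ} := Λᵀ_{n−μ̂,μ}`). -/
theorem inner_linkCoupling (m n : Λ) (v w : E) :
    ⟪linkCoupling src tgt R m n v, w⟫ = ⟪v, linkCoupling src tgt R n m w⟫ := by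
  rw [linkCoupling_apply, linkCoupling_apply, sum_inner, inner_sum]
  refine Finset.sum_congr rfl fun ℓ _ => ?_
  rw [inner_add_left, inner_add_right, add_comm]
  congr 1
  · split_ifs <;> simp [inner_apply_left_eq_symm]
  · split_ifs <;> simp [inner_symm_apply_left]

variable [Fintype Λ]

/-- A double sum over sites and over the links with a given endpoint at that site collapses to a
sum over links. -/
theorem sum_sum_filter_eq {M : Type*} [AddCommMonoid M] (g : Lk → Λ) (f : Lk → Λ → M) :
    ∑ n, ∑ ℓ ∈ Finset.univ.filter (fun ℓ => g ℓ = n), f ℓ n = ∑ ℓ, f ℓ (g ℓ) := by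
  calc ∑ n, ∑ ℓ ∈ Finset.univ.filter (fun ℓ => g ℓ = n), f ℓ n
      = ∑ n, ∑ ℓ ∈ Finset.univ.filter (fun ℓ => g ℓ = n), f ℓ (g ℓ) :=
        Finset.sum_congr rfl fun n _ => Finset.sum_congr rfl fun ℓ hℓ => by
          rw [(Finset.mem_filter.1 hℓ).2]
    _ = ∑ ℓ, f ℓ (g ℓ) := Finset.sum_fiberwise _ _ _

/-- **E–S eq. (7), the spin sum**: `J_n = Σ_{ℓ : src ℓ = n} R_ℓ⁻¹ x_{tgt ℓ} + Σ_{ℓ : tgt ℓ = n} R_ℓ x_{src ℓ}`. -/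
theorem localField_linkCoupling (n : Λ) (x : Λ → E) :
    localField (linkCoupling src tgt R) n x =
      ∑ ℓ ∈ Finset.univ.filter (fun ℓ => src ℓ = n), (R ℓ).symm (x (tgt ℓ)) +
        ∑ ℓ ∈ Finset.univ.filter (fun ℓ => tgt ℓ = n), R ℓ (x (src ℓ)) := by
  simp only [localField, linkCoupling_apply, Finset.sum_add_distrib, Finset.sum_filter]
  congr 1
  · rw [Finset.sum_comm]
    exact Finset.sum_congr rfl fun ℓ _ => by by_cases h : src ℓ = n <;> simp [h]
  · rw [Finset.sum_comm]
    exact Finset.sum_congr rfl fun ℓ _ => by by_cases h : tgt ℓ = n <;> simp [h]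

/-- **E–S eq. (6) = eq. (1)**: `−κ Σ_n ⟪x_n, J_n⟫ + S₀ = −2κ Σ_ℓ ⟪x_{tgt ℓ}, R_ℓ x_{src ℓ}⟫ + S₀` —
each link enters `Σ_n x_nᵀ J_n` once from each end. -/
theorem esAction_linkCoupling (κ S₀ : ℝ) (x : Λ → E) :
    esAction κ S₀ (linkCoupling src tgt R) x = linkAction κ S₀ src tgt R x := by
  have h1 : ∑ n, ⟪x n, localField (linkCoupling src tgt R) n x⟫ =
      2 * ∑ ℓ, ⟪x (tgt ℓ), R ℓ (x (src ℓ))⟫ := by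
    simp only [localField_linkCoupling, inner_add_right, inner_sum, Finset.sum_add_distrib]
    rw [sum_sum_filter_eq src (fun ℓ m => ⟪x m, (R ℓ).symm (x (tgt ℓ))⟫),
      sum_sum_filter_eq tgt (fun ℓ m => ⟪x m, R ℓ (x (src ℓ))⟫)]
    have h : ∀ ℓ, ⟪x (src ℓ), (R ℓ).symm (x (tgt ℓ))⟫ = ⟪x (tgt ℓ), R ℓ (x (src ℓ))⟫ :=
      fun ℓ => by rw [← inner_apply_left_eq_symm, real_inner_comm]
    simp only [h, two_mul]
  unfold esAction linkAction
  rw [h1]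
  ring

end Links

/-! ## §2 The leading-order statements for the model of record, with "no loops" as the only hypothesis on the couplings -/

section Consequences

variable [Fintype Λ] [FiniteDimensional ℝ E] (src tgt : Lk → Λ) (R : Lk → (E ≃ₗᵢ[ℝ] E))

/-- **E–S eq. (15) for the link action**: `−Σ_n ∂̃_n·∂̃_n S̃⁽⁰⁾ = S − S₀`, `S̃⁽⁰⁾ = S/(2(d−1))`, on the
product of unit spheres, for any loop-free graph of linear-isometric transporters and `d ≥ 2`. -/
theorem neg_sum_siteLaplacian_linkAction (hloop : ∀ ℓ, src ℓ ≠ tgt ℓ)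
    (hd : 2 ≤ Module.finrank ℝ E) (κ S₀ : ℝ) {x : Λ → E} (hx : ∀ n, ‖x n‖ = 1) :
    -∑ n, siteLaplacian n (loFlowAction κ S₀ (linkCoupling src tgt R)) x =
      linkAction κ S₀ src tgt R x - S₀ := by
  rw [← esAction_linkCoupling]
  exact neg_sum_siteLaplacian_loFlowAction (linkCoupling_self src tgt R hloop)
    (inner_linkCoupling src tgt R) hd κ S₀ hx

/-- **E–S eq. (16) for the link action**: `T_n = (κ/(d−1)) p_n`, `p_n = tangentKick (J_n x) (x n)`. -/
theorem loGenerator_link_eq (hloop : ∀ ℓ, src ℓ ≠ tgt ℓ) (hd : 2 ≤ Module.finrank ℝ E)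
    (κ S₀ : ℝ) {x : Λ → E} {n : Λ} (hx : ‖x n‖ = 1) :
    loGenerator κ S₀ (linkCoupling src tgt R) n x =
      (κ / ((Module.finrank ℝ E : ℝ) - 1)) •
        tangentKick (localField (linkCoupling src tgt R) n x) (x n) :=
  loGenerator_eq (linkCoupling_self src tgt R hloop) (inner_linkCoupling src tgt R) hd κ S₀ hx

/-- **E–S eq. (17) for the link action**: the Euler step of the leading-order flow at site `n` is
`geodesicKick (ε κ/(d−1)) (J_n x) (x n)`. -/
theorem eulerStep_loGenerator_link (hloop : ∀ ℓ, src ℓ ≠ tgt ℓ) (hd : 2 ≤ Module.finrank ℝ E)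
    {κ : ℝ} (hκ : 0 ≤ κ) (S₀ ε : ℝ) {x : Λ → E} {n : Λ} (hx : ‖x n‖ = 1) :
    eulerStep ε (loGenerator κ S₀ (linkCoupling src tgt R) n x) (x n) =
      geodesicKick (ε * (κ / ((Module.finrank ℝ E : ℝ) - 1)))
        (localField (linkCoupling src tgt R) n x) (x n) :=
  eulerStep_loGenerator (linkCoupling_self src tgt R hloop) (inner_linkCoupling src tgt R) hd hκ S₀
    ε hx

/-- **The rung's site map is the Euler step of the leading-order flow.**  GEN-5's single-site update
`SphereKickJacobian.sphereKick c J` (the map swept over the checkerboard classes in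
`SphereKickSweep*.lean`, whose THMC exactness is `SphereSweepTHMC*.lean`), taken at the local field
`J = J_n x` with step constant `c = ε κ/(d−1)`, is the Euler step of `ẋ = T(x)` at site `n`. -/
theorem coe_sphereKick_eq_eulerStep_loGenerator (hloop : ∀ ℓ, src ℓ ≠ tgt ℓ)
    (hd : 2 ≤ Module.finrank ℝ E) {κ : ℝ} (hκ : 0 ≤ κ) (S₀ ε : ℝ) (x : Λ → Metric.sphere (0 : E) 1)
    (n : Λ) :
    (sphereKick (ε * (κ / ((Module.finrank ℝ E : ℝ) - 1)))
        (localField (linkCoupling src tgt R) n (fun m => (x m : E))) (x n) : E) =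
      eulerStep ε (loGenerator κ S₀ (linkCoupling src tgt R) n (fun m => (x m : E))) (x n) := by
  rw [coe_sphereKick, eulerStep_loGenerator_link src tgt R hloop hd hκ S₀ ε (norm_eq_of_mem_sphere (x n))]

/-- **Lüscher's criterion at `t = 0` for the link action**: `Σ_n div_n T = S − S₀`. -/
theorem sum_siteDiv_loGenerator_link (hloop : ∀ ℓ, src ℓ ≠ tgt ℓ) (hd : 2 ≤ Module.finrank ℝ E)
    (κ S₀ : ℝ) {x : Λ → E} (hx : ∀ n, ‖x n‖ = 1) :
    ∑ n, siteDiv n (loGenerator κ S₀ (linkCoupling src tgt R) n) x =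
      linkAction κ S₀ src tgt R x - S₀ := by
  rw [← esAction_linkCoupling]
  exact sum_siteDiv_loGenerator (linkCoupling_self src tgt R hloop) (inner_linkCoupling src tgt R)
    hd κ S₀ hx

end Consequences

/-! ## §3 The CP(N−1) dictionary: `U(1)` phases as transporters on `ℂ^N ≅ ℝ^{2N}`; the link action is E–S eq. (1) -/

section CPN

open Matrix WithLp

variable {n : Type*} [Fintype n] [DecidableEq n]

/- Row 9's `E n` is `EuclideanSpace ℝ (n ⊕ n)` (`ComplexSphereAction.lean`); it is spelled out here
because this file's ambient space is also called `E`. -/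

/-- A unit complex number acting diagonally on `ℂ^N` is a unitary matrix. -/
theorem smul_one_mem_unitaryGroup {c : ℂ} (hc : ‖c‖ = 1) :
    c • (1 : Matrix n n ℂ) ∈ Matrix.unitaryGroup n ℂ := by
  rw [Matrix.mem_unitaryGroup_iff, star_smul, star_one, Matrix.smul_mul, Matrix.mul_smul,
    Matrix.mul_one, smul_smul, Complex.star_def, Complex.mul_conj, Complex.normSq_eq_norm_sq, hc]
  simp

/-- **The `U(1)` link phase as a transporter**: multiplication by the unit complex number `c` on
`ℂ^N`, as a real linear isometry of `ℝ^{2N}` (row 9's `rotC` of the unitary matrix `c • 1`). -/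
def phaseRot (c : ℂ) (hc : ‖c‖ = 1) : EuclideanSpace ℝ (n ⊕ n) ≃ₗᵢ[ℝ] EuclideanSpace ℝ (n ⊕ n) :=
  rotC (c • (1 : Matrix n n ℂ)) (smul_one_mem_unitaryGroup hc)

/-- In complex coordinates the phase transporter multiplies by the phase. -/
theorem cplx_phaseRot {c : ℂ} (hc : ‖c‖ = 1) (x : EuclideanSpace ℝ (n ⊕ n)) : cplx (phaseRot c hc x) = c • cplx x := by
  rw [phaseRot, cplx_rotC, Matrix.smul_mulVec, Matrix.one_mulVec]

omit [DecidableEq n] in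
/-- The real inner product of `ℝ^{2N}` in complex coordinates: `⟪x, y⟫ = Re Σᵢ conj(zᵢ) wᵢ`
(`z = cplx x`, `w = cplx y`; row 9's `realify_dotProduct`). -/
theorem inner_eq_re_sum_conj_mul (x y : EuclideanSpace ℝ (n ⊕ n)) :
    ⟪x, y⟫ = (∑ i, (starRingEnd ℂ) (cplx x i) * cplx y i).re := by
  rw [← realify_dotProduct, EuclideanSpace.inner_eq_star_dotProduct, star_trivial, dotProduct_comm]
  simp only [cplx, realify_complexify]

omit [DecidableEq Λ] in
/-- **E–S eq. (1), first form.**  With `U(1)` phases `λ_ℓ` (`‖λ_ℓ‖ = 1`) as the transporters and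
`z_n = cplx (x n)` the complex site vectors, `linkAction κ S₀ … x = −2κ Σ_ℓ Re(λ_ℓ z†_{tgt ℓ} z_{src ℓ}) + S₀`. -/
theorem linkAction_phase (κ S₀ : ℝ) (src tgt : Lk → Λ) (lam : Lk → ℂ) (hlam : ∀ ℓ, ‖lam ℓ‖ = 1)
    (x : Λ → EuclideanSpace ℝ (n ⊕ n)) :
    linkAction κ S₀ src tgt (fun ℓ => phaseRot (lam ℓ) (hlam ℓ)) x =
      -(2 * κ) * ∑ ℓ, (lam ℓ * ∑ i, (starRingEnd ℂ) (cplx (x (tgt ℓ)) i) * cplx (x (src ℓ)) i).re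
        + S₀ := by
  unfold linkAction
  congr 2
  refine Finset.sum_congr rfl fun ℓ _ => ?_
  rw [inner_eq_re_sum_conj_mul, cplx_phaseRot, Finset.mul_sum]
  congr 1
  refine Finset.sum_congr rfl fun i _ => ?_
  rw [Pi.smul_apply, smul_eq_mul]
  ring

omit [DecidableEq Λ] in
/-- **E–S eq. (1) verbatim**: with `S₀ = 2κ · #Lk` (`κ = Nβ`; on the periodic square lattice
`#Lk = 2V`, so `S₀ = 4NβV` as in eq. (6)),
`S = −κ Σ_ℓ (2 Re(λ_ℓ z†_{tgt ℓ} z_{src ℓ}) − 2) = −Nβ Σ_{n,μ} (z†_{n+μ̂} z_n λ_{n,μ} + c.c. − 2)`. -/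
theorem linkAction_phase_es (κ : ℝ) (src tgt : Lk → Λ) (lam : Lk → ℂ) (hlam : ∀ ℓ, ‖lam ℓ‖ = 1)
    (x : Λ → EuclideanSpace ℝ (n ⊕ n)) :
    linkAction κ (2 * κ * Fintype.card Lk) src tgt (fun ℓ => phaseRot (lam ℓ) (hlam ℓ)) x =
      -κ * ∑ ℓ, (2 * (lam ℓ * ∑ i, (starRingEnd ℂ) (cplx (x (tgt ℓ)) i) * cplx (x (src ℓ)) i).re
        - 2) := by
  rw [linkAction_phase, Finset.sum_sub_distrib, Finset.sum_const, Finset.card_univ, ← Finset.mul_sum]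
  simp only [nsmul_eq_mul]
  ring

end CPN

end Summit.Ventures.LatticeQCDFlow.Exactness

end
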